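import Literature.MathematicalPhysics.QuantumFieldTheory.Balaban1983to89.B9Thm37GpTorusRegular
import Literature.MathematicalPhysics.QuantumFieldTheory.Balaban1983to89.B9Ineq349Hom
import Literature.MathematicalPhysics.QuantumFieldTheory.Balaban1983to89.B9Eq376POneLetters
import Literature.MathematicalPhysics.QuantumFieldTheory.Balaban1983to89.B9Eq3104CutoffCommutatorSizes

/-!
# `Balaban1983to89.B9Thm39CinvSandwichQ` — [Balaban1985BackgroundPropagators] (3.21)/(3.24) pp. 394–395 + (3.95) p. 411: THE `Q′(U)( · )Q′*(U)`
# SANDWICH AT def-Y's LETTERS — `Q′(U)` (sites → blocks) and `Q′*(U)` (blocks → sites) are BLOCK-LOCAL two-space letters of norm `≦ 1` (unitary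
# transporters), so a block majorant `K` of a site letter `T` (real coordinates, carrier block map `(z, j) ↦ ιB(Δ(z))`) is, up to the coordinate
# constant, a block majorant of `Q′(U)·T·Q′*(U)` on the block carrier (`(s, j) ↦ ιB(s)`); the displayed input `hL` of M5.6 FILE 2 for
# `L = Q′G′²Q′*` from M5.5's (3.42)₁ and FILE 3a (cell `lit-balaban`, G-B9-LETTERS module M5.6 FILE 3b, seat p21 gen 32)

statement-level skeleton of published theorems with citation tags; proofs where landed; nothing here is a claim about the Yang–Mills mass gap

CITATION HEADER (lean-in-tree rule).  B9 = T. Bałaban, *Propagators for lattice gauge theories in a background field*, Commun. Math. Phys. **99** (1985)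
389–434 (journal page = PDF page + 388).  p. 394 (3.21) «Q′(U)» with the transporters «U(Γ_{y,x})» along contours inside the block; p. 395 (3.24)–(3.25)
«Rf = (I − G′Q′*(Q′G′²Q′*)⁻¹Q′G′)f» (the adjoint `Q′*`); p. 393 (3.19) (the block averages: value on `Δ(y)` from the argument on `Δ(y)` only); p. 397
(3.42) (Theorem 3.1, the block-majorant shape «|(G′(U)λ)(x)| ≦ B₀(Lʲη)²e^{−δ₀d(y,y′)}|λ| for x ∈ Δ(y), y ∈ Λ_j, supp λ ⊂ Δ(y′)»); p. 411 (3.95) (the letter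
`Q′G′²Q′*` in the three sums, estimated «by the same estimates as in [4], especially (2.83)–(2.85)»).  [4] = [Balaban1984PropagatorsII] T. Bałaban,
*Propagators and renormalization transformations for lattice gauge theories. II*, Commun. Math. Phys. **96** (1984) 223–250: (2.51)–(2.52) p. 232 («|(Tλ)(x)|
≦ K(y,y′)|λ|», «A composition of operators preserves the above property»), (2.14)–(2.17) p. 225 (the block average `Q′` and `Q′*`), (2.83) p. 237 (the
factor «O(1)(Lʲη)⁴e^{−½δ₀d(y,y″)}» of `Q′G′²Q′*`).  Rows B9.Eq3.95 × B9.Eq3.21 × B4.Eq2.83 × B4.Eq2.52 (cells only; no row head changes).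

WHY THIS FILE (M5.6 = [B9] Thm 3.9 ⇒ Thm 3.2 (3.48) for `C(U) = (Q′G′²Q′*)⁻¹(U)`, r06's `B9-LETTERS-MAP.md` §4).  FILE 1 (`B9Thm39CinvTorusRegular`) reads
`C(U)` on def-Y's BLOCK carrier `BlkY i × ι` (block map `(s, j) ↦ ιB s`); FILE 2 (`B9Thm39CinvFirstSum`) takes the upper majorant `hL` of `L = Q′G′²Q′*`
THERE; M5.5 (`B9Thm37GpTorusRegular*`) and FILE 3a (`B9Thm39CinvUpperL`) deliver the majorant of `η⁴G′(U)²` on def-Y's SITE carrier `SiteY i × ι` (block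
map `(z, j) ↦ ιB(Δ(z))`).  THIS FILE is the bridge: def-Y's `Q′(U) = QpY` and `Q′*(U) = QpsY` ((3.21)/(3.24): block averages resp. block-constant
extensions with parallel transporters `U(Γ_{y,x})`) are, for contractive (unitary) transporters, BLOCK-LOCAL two-space letters with the block-diagonal
majorant `κ_Q·𝟙[y = y′]`, `κ_Q = M₂·Σ_j‖b_j‖` (the coordinate constant of the basis `b`; print: `1`), and r06's two-space calculus
(`B9Ineq349Hom.hasMajorantHom_local_comp` / `hasMajorantHom_comp_local`, [4] (2.52)) sandwiches ANY site letter between them at no cost in the rate.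

WHAT IS PROVED (all `theorem`s, 0 `def`, 0 sorry, 0 new named facts).
* §1 the letters pointwise: `QpY_apply_eq_zero_of` / `norm_QpY_apply_le` (`(Q′Λ)(s)` depends on `Λ|Δ(s)` only and `‖(Q′Λ)(s)‖ ≦ max_{Δ(s)}‖Λ‖` —
  `Σ_z|q(s,z)| ≦ 1`, `‖R(τ)X‖ ≦ ‖X‖`; the kernel support is p38's `B9Eq3104CutoffCommutatorSizes.qpK_ne_zero_imp`, BY NAME), `QpsY_apply` / `norm_QpsY_apply_le` (`(Q′*λ)(z) = R(τ(s_z,z)⁻¹)λ(s_z)`, `‖(Q′*λ)(z)‖ ≦ ‖λ(s_z)‖`).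
* §2 ★ `hasMajorantHom_conjHom_QpY` / ★ `hasMajorantHom_conjHom_QpsY` — in real coordinates (`B9Eq376POneLetters.conjHom b`) the two letters have the
  block-diagonal two-space majorant `𝟙[a = a′]·M₂Σ_j‖b_j‖` between the site carrier (`(z, j) ↦ ιB(Δ(z))`) and the block carrier (`(s, j) ↦ ιB s`).
* §3 ★★ `hasMajorant_conj_sandwich` — GENERIC: block-local letters `Qr : sites → blocks`, `Qsr : blocks → sites` with diagonal majorants `κ₁𝟙`, `κ₂𝟙`
  and a site letter `T` with `conj b T ≺ K` (`K ≧ 0`) give `conj b (Qr ∘ T ∘ Qsr) ≺ κ₁κ₂·K` on the block carrier ([4] (2.52) twice, no rate loss);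
  ★★ `hasMajorant_conj_QpY_sandwich_QpsY` — at def-Y's `Q′(U)`, `Q′*(U)`: `conj b (Q′(U) ∘ T ∘ Q′*(U)) ≺ (M₂Σ_j‖b_j‖)²·K`.
* §4 ★★ `hasMajorant_conj_XY_of_site` — AT THE MEMBER'S LETTER `XY i parS G′ U = Q′(U)G′(U)²Q′*(U)` (def-Y `Node00.XY`): a majorant `K` of
  `conj b (s•(G′·G′))` on the site carrier (M5.5 + FILE 3a: `B²Cc₁·ℓ(a)⁴·e^{−(1−α′)(1−α_st)δd}`, `s = η⁴`) gives the majorant `(M₂Σ_j‖b_j‖)²·K` of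
  `conj b (s•XY)` on the block carrier — the displayed `hL` of FILE 2 (`κ·P(a)⁻¹·e^{−a_Lδ₀d}`, `P = ℓ⁻⁴`) up to the names of the constants.

HONEST SCOPE.  Finite-dimensional bookkeeping over def-Y's definitions (`QpY`, `QpsY`, `XY`, `qpK = QM`, `qpsK = QsM`, `qpT`) and r06's/pv21's majorant
calculus; the transporters enter only through CONTRACTIVITY `‖τ‖, ‖τ⁻¹‖ ≦ 1` (hypothesis `hpar`; unitary matrices in print, where `κ_Q = 1` and the
coordinate constant is an artefact of reading `𝔸`-valued letters through a real basis); the site majorant `K` is a hypothesis of the printed shape (M5.5's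
★★ and FILE 3a at the member).  Nothing of Theorem 3.1/3.2/3.9 is asserted here; NOT summit progress.
RELATED, NOT DUPLICATED (searched 2026-08-28: `lean search 'conjHom_QpY|QpY_sandwich|conj_XY|norm_QpY_apply_le' --decl` = ∅; `rg QpY` over the topic
read): `B9Ineq349SiteFromConv342.QpsY_deltaY_apply`/`norm_QpsY_deltaY_le` (the `Q′*` letter on DELTA sources only — §1 is the general-argument form,
same three-line proof), `B9Eq395Hom.sandwich_majorant`/`lloc_majorant` (THE SAME SANDWICH DEVICE on the SCALAR block carrier `g.Site → ℝ` with the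
identity block map — §3 is its twin for def-Y's `𝔸`-valued block carrier `BlkY i × ι`, block map `(s, j) ↦ ιB s`; the two `hasMajorantHom_comp` steps
are taken from `B9Ineq349Hom.hasMajorantHom_local_comp`/`_comp_local` BY NAME), `B9Ineq377POneKernelFinal` (the diagonal majorants of (3.19) letters), `B9Eq376POneLetters.hasMajorantHom_conj_of_local` (stencil-local
letters ⇒ EXPONENTIAL-shape majorant; the diagonal shape is kept here so that the sandwich costs no (2.61) factor), `Node00.OpsYRead342.hasMajorant_conj_of_ball_bound`
(site carrier, ball reading), `B13OpsYPencilAveraging.norm_coord_QpY_prodCfg_le` (the pencil `U₀e^{ηA}`, analytic in `A`; different object).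
-/

noncomputable section

namespace Literature.MathematicalPhysics.QuantumFieldTheory.Balaban1983to89.B9Thm39CinvSandwichQ

open Node00
open B6Geom246MultiLevelBox (blkOf)
open B6KLevelCensusIndexV1 (KIdx)
open B6RandomWalk (HasMajorant BlockSupp hasMajorant_mono)
open B6RandomWalkHom (HasMajorantHom hasMajorantHom_mono hasMajorantHom_iff)
open B9Thm34Ext (toB6)
open B9GeoNormsKLevelV1 (geo9K)
open B9Eq39Adjoint (R R_def)
open B9Eq352DivFormLetters (coordEquiv conj conj_apply coordEquiv_apply coordEquiv_symm_apply norm_coordSymm_apply_le)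
open B9Eq376POneLetters (conjHom conjHom_apply conjHom_comp conjHom_eq_conj)
open B9Ineq349Hom (hasMajorantHom_local_comp hasMajorantHom_comp_local)
open B6Ineq268MultiLevelBox (qB sum_abs_qB_le)
open B9Eq360Vprime (norm_R_le_of_unit)
open B9Eq3104CutoffCommutatorSizes (qpK_ne_zero_imp)

variable {d ℓ : ℕ} {hd : 1 ≤ d + 1} {hL : Odd (ℓ + 1) ∧ 1 < ℓ + 1} {b₀ b₁ : ℝ}
variable {𝔸 : Type} [NormedRing 𝔸] [NormedAlgebra ℂ 𝔸] [CompleteSpace 𝔸]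
variable {ι : Type} [Fintype ι]
variable (i : KIdx d ℓ hd hL b₀ b₁) (b : Module.Basis ι ℝ 𝔸)

/-! ## §1 The letters `Q′(U)`, `Q′*(U)` pointwise: block-locality and contraction -/

section Letters

variable (parS : SiteParY 𝔸 i) (U : CfgY 𝔸 i)

/-- the `Q′` kernel IS [4]'s normalised block-average kernel `q(s, z) = W(s)⁻¹·[z ∈ Δ(s)]` (p21's `QM` = pv's `qB`, same expression).
[cite: Balaban1984PropagatorsII, (2.14) p.225, dictionary] -/
theorem qpK_eq_qB (s : BlkY i) (z : SiteY i) : qpK i s z = qB i.D.toDomains s z := rfl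

/-- `Σ_z |q(s, z)| ≦ 1` (the block average is a sub-probability: `#Δ(s)·W(s)⁻¹ ≦ 1`). [cite: Balaban1984PropagatorsII, (2.14) p.225 + (2.69) p.235, bookkeeping] -/
theorem sum_abs_qpK_le_one (s : BlkY i) : ∑ z, |qpK i s z| ≤ 1 :=
  sum_abs_qB_le i.D.toDomains s

/-- ★ **`Q′(U)` IS BLOCK-LOCAL**: if `Λ` vanishes on `Δ(s)` then `(Q′(U)Λ)(s) = 0` ((3.21): the average over the block `Δ(s)` of the transported values).
[cite: Balaban1985BackgroundPropagators, (3.21) p.394; Balaban1984PropagatorsII, (2.14) p.225] -/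
theorem QpY_apply_eq_zero_of (Λ : SiteY i → 𝔸) (s : BlkY i) (hΛ : ∀ z, blkOf i.D.toDomains z = s → Λ z = 0) : QpY i parS U Λ s = 0 := by
  rw [QpY, trLiftY_apply]
  refine Finset.sum_eq_zero fun z _ => ?_
  by_cases hq : qpK i s z = 0
  · rw [hq, Complex.ofReal_zero, zero_smul]
  · rw [hΛ z (qpK_ne_zero_imp i hq), B9Eq39Adjoint.R_zero, smul_zero]

/-- ★ **`Q′(U)` IS A CONTRACTION IN THE BLOCK SUP** (contractive transporters): `‖Λ(z)‖ ≦ B` on `Δ(s)` ⇒ `‖(Q′(U)Λ)(s)‖ ≦ B`.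
[cite: Balaban1985BackgroundPropagators, (3.21) p.394; Balaban1984PropagatorsII, (2.14) p.225] -/
theorem norm_QpY_apply_le (hpar : ∀ z w : SiteY i, ‖(parS U z w : 𝔸)‖ ≤ 1 ∧ ‖(((parS U z w)⁻¹ : 𝔸ˣ) : 𝔸)‖ ≤ 1)
    (Λ : SiteY i → 𝔸) (s : BlkY i) {B : ℝ} (hB : 0 ≤ B) (hΛ : ∀ z, blkOf i.D.toDomains z = s → ‖Λ z‖ ≤ B) :
    ‖QpY i parS U Λ s‖ ≤ B := by
  rw [QpY, trLiftY_apply]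
  have hterm : ∀ z : SiteY i, ‖(((qpK i s z : ℝ)) : ℂ) • R (qpT i parS U s z) (Λ z)‖ ≤ |qpK i s z| * B := by
    intro z
    rw [norm_smul, Complex.norm_real, Real.norm_eq_abs]
    by_cases hq : qpK i s z = 0
    · rw [hq, abs_zero, zero_mul, zero_mul]
    · exact mul_le_mul_of_nonneg_left ((norm_R_le_of_unit _ _ (hpar _ _)).trans (hΛ z (qpK_ne_zero_imp i hq))) (abs_nonneg _)
  calc ‖∑ z, (((qpK i s z : ℝ)) : ℂ) • R (qpT i parS U s z) (Λ z)‖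
      ≤ ∑ z, |qpK i s z| * B := (norm_sum_le _ _).trans (Finset.sum_le_sum fun z _ => hterm z)
    _ = (∑ z, |qpK i s z|) * B := by rw [Finset.sum_mul]
    _ ≤ 1 * B := mul_le_mul_of_nonneg_right (sum_abs_qpK_le_one i s) hB
    _ = B := one_mul B

/-- ★ **`Q′*(U)` EVALUATED**: `(Q′*(U)λ)(z) = R(τ(s_z, z)⁻¹)λ(s_z)`, `s_z` the block of `z` ((3.24): the block value transported back to the site).
[cite: Balaban1985BackgroundPropagators, (3.24)–(3.25) p.395; Balaban1984PropagatorsII, (2.16) p.225] -/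
theorem QpsY_apply (lam : BlkY i → 𝔸) (z : SiteY i) :
    QpsY i parS U lam z = R (qpT i parS U (blkOf i.D.toDomains z) z)⁻¹ (lam (blkOf i.D.toDomains z)) := by
  rw [QpsY, trLiftY_apply, Finset.sum_eq_single (blkOf i.D.toDomains z)]
  · have hker : qpsK i z (blkOf i.D.toDomains z) = 1 := if_pos rfl
    rw [hker, Complex.ofReal_one, one_smul]
  · intro s _ hs
    have hker : qpsK i z s = 0 := if_neg (Ne.symm hs)
    rw [hker, Complex.ofReal_zero, zero_smul]
  · intro h; exact absurd (Finset.mem_univ _) h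

/-- ★ **`Q′*(U)` IS A CONTRACTION** (contractive transporters): `‖(Q′*(U)λ)(z)‖ ≦ ‖λ(s_z)‖`.
[cite: Balaban1985BackgroundPropagators, (3.24)–(3.25) p.395; Balaban1984PropagatorsII, (2.16) p.225] -/
theorem norm_QpsY_apply_le (hpar : ∀ z w : SiteY i, ‖(parS U z w : 𝔸)‖ ≤ 1 ∧ ‖(((parS U z w)⁻¹ : 𝔸ˣ) : 𝔸)‖ ≤ 1)
    (lam : BlkY i → 𝔸) (z : SiteY i) : ‖QpsY i parS U lam z‖ ≤ ‖lam (blkOf i.D.toDomains z)‖ := by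
  rw [QpsY_apply]
  obtain ⟨h1, h2⟩ := hpar (blkCornerY i (blkOf i.D.toDomains z)) z
  refine norm_R_le_of_unit _ _ ⟨h2, ?_⟩
  rw [inv_inv]; exact h1

end Letters

/-! ## §2 The two letters in real coordinates: block-diagonal two-space majorants between the site and the block carrier -/

section Coordinates

variable [Fintype (geo9K i).Site] [DecidableEq (geo9K i).Site] {Rr : ℝ} {Hp : Prop}
variable (ιB : BlkY i → IBondY i) (parS : SiteParY 𝔸 i) (U : CfgY 𝔸 i)

omit [CompleteSpace 𝔸] [Fintype (geo9K i).Site] [DecidableEq (geo9K i).Site] in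
/-- the synthesis bound on a block: if `|μ(z, j)| ≦ B` for the sites `z` of `Δ(s)` then `‖(coord⁻¹μ)(z)‖ ≦ (Σ_j‖b_j‖)·B` there.
[cite: Balaban1984PropagatorsII, (2.51) p.232 («|λ|»), bookkeeping] -/
private theorem norm_coordSymm_le_on_blk (μ : SiteY i × ι → ℝ) (s : BlkY i) {B : ℝ}
    (hμ : ∀ p : SiteY i × ι, blkOf i.D.toDomains p.1 = s → |μ p| ≤ B) (z : SiteY i) (hz : blkOf i.D.toDomains z = s) :
    ‖(coordEquiv b).symm μ z‖ ≤ (∑ j, ‖b j‖) * B :=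
  norm_coordSymm_apply_le b μ z B fun j => hμ (z, j) hz

/-- ★ **`Q′(U)` IN REAL COORDINATES IS BLOCK-LOCAL WITH NORM `M₂Σ_j‖b_j‖`**: `conjHom b Q′(U)` has the two-space majorant `𝟙[a = a′]·M₂Σ_j‖b_j‖` from the site
carrier (block map `(z, j) ↦ ιB(Δ(z))`) to the block carrier (`(s, j) ↦ ιB s`) — (3.21) read as [4] (2.51) with `K(y, y′) = 𝟙[y = y′]`.
[cite: Balaban1985BackgroundPropagators, (3.21) p.394 + (3.42) p.397; Balaban1984PropagatorsII, (2.51) p.232 + (2.14) p.225] -/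
theorem hasMajorantHom_conjHom_QpY (hpar : ∀ z w : SiteY i, ‖(parS U z w : 𝔸)‖ ≤ 1 ∧ ‖(((parS U z w)⁻¹ : 𝔸ˣ) : 𝔸)‖ ≤ 1)
    {M₂ : ℝ} (hM₂ : 0 ≤ M₂) (hrepr : ∀ (v : 𝔸) (j : ι), |b.repr v j| ≤ M₂ * ‖v‖) :
    HasMajorantHom (g := toB6 (geo9K i) Rr Hp) (fun p : SiteY i × ι => ιB (blkOf i.D.toDomains p.1)) (fun q : BlkY i × ι => ιB q.1)
      (conjHom b ((QpY i parS U).restrictScalars ℝ)) (fun a a' : (geo9K i).Site => if a = a' then M₂ * ∑ j, ‖b j‖ else 0) := by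
  intro y' μ B hμ q
  rw [conjHom_apply, LinearMap.restrictScalars_apply]
  dsimp only
  split_ifs with hq
  · -- the block `q.1` IS the source block: contraction of the block average
    have hbd : ∀ p : SiteY i × ι, blkOf i.D.toDomains p.1 = q.1 → |μ p| ≤ B := fun p hp =>
      hμ.bound p ((congrArg ιB hp).trans hq)
    have hSb : 0 ≤ (∑ j, ‖b j‖) * B := mul_nonneg (Finset.sum_nonneg fun j _ => norm_nonneg _) hμ.nonneg
    have h1 : ‖QpY i parS U ((coordEquiv b).symm μ) q.1‖ ≤ (∑ j, ‖b j‖) * B :=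
      norm_QpY_apply_le i parS U hpar _ q.1 hSb fun z hz => norm_coordSymm_le_on_blk i b μ q.1 hbd z hz
    calc |b.repr (QpY i parS U ((coordEquiv b).symm μ) q.1) q.2|
        ≤ M₂ * ‖QpY i parS U ((coordEquiv b).symm μ) q.1‖ := hrepr _ _
      _ ≤ M₂ * ((∑ j, ‖b j‖) * B) := mul_le_mul_of_nonneg_left h1 hM₂
      _ = M₂ * (∑ j, ‖b j‖) * B := by ring
  · -- a different block: the argument vanishes on `Δ(q.1)`, so does the average
    have h0 : QpY i parS U ((coordEquiv b).symm μ) q.1 = 0 := by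
      refine QpY_apply_eq_zero_of i parS U _ q.1 fun z hz => ?_
      rw [coordEquiv_symm_apply]
      refine Finset.sum_eq_zero fun j _ => ?_
      rw [hμ.off (z, j) fun h => hq ((congrArg ιB hz).symm.trans h), zero_smul]
    rw [h0, map_zero, Finsupp.zero_apply, abs_zero, zero_mul]

/-- ★ **`Q′*(U)` IN REAL COORDINATES IS BLOCK-LOCAL WITH NORM `M₂Σ_j‖b_j‖`**: `conjHom b Q′*(U)` has the two-space majorant `𝟙[a = a′]·M₂Σ_j‖b_j‖` from the
block carrier to the site carrier ((3.24) read as [4] (2.51)). [cite: Balaban1985BackgroundPropagators, (3.24)–(3.25) p.395 + (3.42) p.397; Balaban1984PropagatorsII, (2.51) p.232 + (2.16) p.225] -/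
theorem hasMajorantHom_conjHom_QpsY (hpar : ∀ z w : SiteY i, ‖(parS U z w : 𝔸)‖ ≤ 1 ∧ ‖(((parS U z w)⁻¹ : 𝔸ˣ) : 𝔸)‖ ≤ 1)
    {M₂ : ℝ} (hM₂ : 0 ≤ M₂) (hrepr : ∀ (v : 𝔸) (j : ι), |b.repr v j| ≤ M₂ * ‖v‖) :
    HasMajorantHom (g := toB6 (geo9K i) Rr Hp) (fun q : BlkY i × ι => ιB q.1) (fun p : SiteY i × ι => ιB (blkOf i.D.toDomains p.1))
      (conjHom b ((QpsY i parS U).restrictScalars ℝ)) (fun a a' : (geo9K i).Site => if a = a' then M₂ * ∑ j, ‖b j‖ else 0) := by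
  intro y' μ B hμ p
  rw [conjHom_apply, LinearMap.restrictScalars_apply]
  dsimp only
  split_ifs with hp
  · have h1 : ‖QpsY i parS U ((coordEquiv b).symm μ) p.1‖ ≤ (∑ j, ‖b j‖) * B :=
      (norm_QpsY_apply_le i parS U hpar _ p.1).trans
        (norm_coordSymm_apply_le b μ (blkOf i.D.toDomains p.1) B fun j => hμ.bound (blkOf i.D.toDomains p.1, j) hp)
    calc |b.repr (QpsY i parS U ((coordEquiv b).symm μ) p.1) p.2|
        ≤ M₂ * ‖QpsY i parS U ((coordEquiv b).symm μ) p.1‖ := hrepr _ _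
      _ ≤ M₂ * ((∑ j, ‖b j‖) * B) := mul_le_mul_of_nonneg_left h1 hM₂
      _ = M₂ * (∑ j, ‖b j‖) * B := by ring
  · have h0 : QpsY i parS U ((coordEquiv b).symm μ) p.1 = 0 := by
      rw [QpsY_apply, coordEquiv_symm_apply]
      have hs : ∑ j, μ (blkOf i.D.toDomains p.1, j) • b j = 0 :=
        Finset.sum_eq_zero fun j _ => by rw [hμ.off (blkOf i.D.toDomains p.1, j) hp, zero_smul]
      rw [hs, B9Eq39Adjoint.R_zero]
    rw [h0, map_zero, Finsupp.zero_apply, abs_zero, zero_mul]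

end Coordinates

/-! ## §3 ★★ The sandwich: a site letter between two block-local letters keeps its majorant on the block carrier -/

section Sandwich

variable [Fintype (geo9K i).Site] [DecidableEq (geo9K i).Site] {Rr : ℝ} {Hp : Prop}
variable (ιB : BlkY i → IBondY i)

omit [CompleteSpace 𝔸] in
/-- ★★ **THE `Q( · )Q*` SANDWICH, GENERIC** ([4] (2.52) «A composition of operators preserves the above property» twice, through the site carrier): ℝ-linear
letters `Qr : (sites → 𝔸) → (blocks → 𝔸)` and `Qsr : (blocks → 𝔸) → (sites → 𝔸)` whose real-coordinate forms are block-local with diagonal majorants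
`κ₁𝟙[a = a′]`, `κ₂𝟙[a = a′]` (`κ₂ ≧ 0`), and a site letter `T` with `conj b T ≺ K` (`K ≧ 0`, site block map `(z, j) ↦ ιB(Δ(z))`) give
`conj b (Qr ∘ T ∘ Qsr) ≺ κ₁κ₂·K` on the block carrier (block map `(s, j) ↦ ιB s`) — SAME `K`, no (2.61) factor, no rate loss.
[cite: Balaban1984PropagatorsII, (2.52) p.232; Balaban1985BackgroundPropagators, (3.95) p.411 (the letter Q′G′²Q′*)] -/
theorem hasMajorant_conj_sandwich {κ₁ κ₂ : ℝ} (hκ₂ : 0 ≤ κ₂)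
    {Qr : (SiteY i → 𝔸) →ₗ[ℝ] (BlkY i → 𝔸)} {Qsr : (BlkY i → 𝔸) →ₗ[ℝ] (SiteY i → 𝔸)} {T : Module.End ℝ (SiteY i → 𝔸)}
    {K : (geo9K i).Site → (geo9K i).Site → ℝ} (hK : ∀ a a', 0 ≤ K a a')
    (hQ : HasMajorantHom (g := toB6 (geo9K i) Rr Hp) (fun p : SiteY i × ι => ιB (blkOf i.D.toDomains p.1)) (fun q : BlkY i × ι => ιB q.1)
      (conjHom b Qr) (fun a a' : (geo9K i).Site => if a = a' then κ₁ else 0))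
    (hQs : HasMajorantHom (g := toB6 (geo9K i) Rr Hp) (fun q : BlkY i × ι => ιB q.1) (fun p : SiteY i × ι => ιB (blkOf i.D.toDomains p.1))
      (conjHom b Qsr) (fun a a' : (geo9K i).Site => if a = a' then κ₂ else 0))
    (hT : HasMajorant (g := toB6 (geo9K i) Rr Hp) (fun p : SiteY i × ι => ιB (blkOf i.D.toDomains p.1)) (conj b T) K) :
    HasMajorant (g := toB6 (geo9K i) Rr Hp) (fun q : BlkY i × ι => ιB q.1) (conj b (Qr ∘ₗ T ∘ₗ Qsr))
      (fun a a' => κ₁ * κ₂ * K a a') := by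
  -- real coordinates of the word: `conj (Qr ∘ T ∘ Qsr) = conjHom Qr ∘ conj T ∘ conjHom Qsr`
  have hrw : conj b (Qr ∘ₗ T ∘ₗ Qsr) = conjHom b Qr ∘ₗ (conj b T ∘ₗ conjHom b Qsr) := by
    rw [← conjHom_eq_conj, ← conjHom_eq_conj, conjHom_comp, conjHom_comp]
  rw [hrw]
  -- `T ∘ Qsr`: majorant `K·κ₂` (block → site); then `Qr ∘ (T ∘ Qsr)`: `κ₁·(K·κ₂)` (block → block)
  have hT' : HasMajorantHom (g := toB6 (geo9K i) Rr Hp) (fun p : SiteY i × ι => ιB (blkOf i.D.toDomains p.1))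
      (fun p : SiteY i × ι => ιB (blkOf i.D.toDomains p.1)) (conj b T) K := (hasMajorantHom_iff (g := toB6 (geo9K i) Rr Hp) _ _ _).mpr hT
  have h1 := hasMajorantHom_comp_local (g := geo9K i) (R := Rr) (H := Hp) (fun q : BlkY i × ι => ιB q.1) (fun p : SiteY i × ι => ιB (blkOf i.D.toDomains p.1))
    (fun p : SiteY i × ι => ιB (blkOf i.D.toDomains p.1)) κ₂ hκ₂ hT' hQs
  have h2 := hasMajorantHom_local_comp (g := geo9K i) (R := Rr) (H := Hp) (fun q : BlkY i × ι => ιB q.1) (fun p : SiteY i × ι => ιB (blkOf i.D.toDomains p.1))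
    (fun q : BlkY i × ι => ιB q.1) κ₁ (fun a a' => mul_nonneg (hK a a') hκ₂) hQ h1
  exact (hasMajorantHom_iff (g := toB6 (geo9K i) Rr Hp) _ _ _).mp
    (hasMajorantHom_mono (g := toB6 (geo9K i) Rr Hp) _ _ h2 fun a a' => le_of_eq (by ring))

variable (parS : SiteParY 𝔸 i) (U : CfgY 𝔸 i)

/-- ★★ **THE `Q′(U)( · )Q′*(U)` SANDWICH AT def-Y's LETTERS**: for contractive transporters and a real basis `b` with coordinate bound `M₂`, a site letter `T`
with `conj b T ≺ K` (`K ≧ 0`) gives `conj b (Q′(U) ∘ T ∘ Q′*(U)) ≺ (M₂Σ_j‖b_j‖)²·K` on the block carrier.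
[cite: Balaban1985BackgroundPropagators, (3.21) p.394 + (3.24)–(3.25) p.395 + (3.95) p.411; Balaban1984PropagatorsII, (2.52) p.232] -/
theorem hasMajorant_conj_QpY_sandwich_QpsY (hpar : ∀ z w : SiteY i, ‖(parS U z w : 𝔸)‖ ≤ 1 ∧ ‖(((parS U z w)⁻¹ : 𝔸ˣ) : 𝔸)‖ ≤ 1)
    {M₂ : ℝ} (hM₂ : 0 ≤ M₂) (hrepr : ∀ (v : 𝔸) (j : ι), |b.repr v j| ≤ M₂ * ‖v‖)
    {T : Module.End ℝ (SiteY i → 𝔸)} {K : (geo9K i).Site → (geo9K i).Site → ℝ} (hK : ∀ a a', 0 ≤ K a a')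
    (hT : HasMajorant (g := toB6 (geo9K i) Rr Hp) (fun p : SiteY i × ι => ιB (blkOf i.D.toDomains p.1)) (conj b T) K) :
    HasMajorant (g := toB6 (geo9K i) Rr Hp) (fun q : BlkY i × ι => ιB q.1)
      (conj b ((QpY i parS U).restrictScalars ℝ ∘ₗ T ∘ₗ (QpsY i parS U).restrictScalars ℝ))
      (fun a a' => (M₂ * ∑ j, ‖b j‖) ^ 2 * K a a') := by
  have h := hasMajorant_conj_sandwich i b ιB (Rr := Rr) (Hp := Hp) (mul_nonneg hM₂ (Finset.sum_nonneg fun j _ => norm_nonneg (b j))) hK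
    (hasMajorantHom_conjHom_QpY i b ιB parS U hpar hM₂ hrepr) (hasMajorantHom_conjHom_QpsY i b ιB parS U hpar hM₂ hrepr) hT
  exact hasMajorant_mono (g := toB6 (geo9K i) Rr Hp) _ h fun a a' => le_of_eq (by ring)

end Sandwich

/-! ## §4 ★★ At the member's letter `XY = Q′(U)G′(U)²Q′*(U)`: the displayed `hL` of FILE 2 from the site majorant of `η⁴G′(U)²` -/

section Member

variable [Fintype (geo9K i).Site] [DecidableEq (geo9K i).Site] {Rr : ℝ} {Hp : Prop}
variable (ιB : BlkY i → IBondY i) (parS : SiteParY 𝔸 i) (Gp : SiteOpY 𝔸 i) (U : CfgY 𝔸 i)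

omit [Fintype (geo9K i).Site] [DecidableEq (geo9K i).Site] in
/-- `s•(Q′G′²Q′*)` restricted to real scalars is the word `Q′ ∘ (s•(G′·G′)) ∘ Q′*` of ℝ-linear letters (def-Y's `XY` unfolded; the scale weight moved to the
middle factor). [cite: Balaban1985BackgroundPropagators, (3.25) p.395, dictionary] -/
theorem smul_XY_restrictScalars (s : ℝ) :
    s • (XY i parS Gp U).restrictScalars ℝ =
      (QpY i parS U).restrictScalars ℝ ∘ₗ (s • ((Gp U).restrictScalars ℝ * (Gp U).restrictScalars ℝ)) ∘ₗ (QpsY i parS U).restrictScalars ℝ := by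
  rw [LinearMap.smul_comp, LinearMap.comp_smul]
  rfl

/-- ★★ **THE UPPER MAJORANT `hL` OF `L = s•Q′(U)G′(U)²Q′*(U)` ON THE BLOCK CARRIER, FROM THE SITE MAJORANT OF `s•G′(U)²`** (p. 411: the factor `Q′G′²Q′*` of
the three sums of (3.95), estimated as in [4] (2.83) by «O(1)(Lʲη)⁴e^{−½δ₀d(y,y″)}»): if `conj b (s•(G′·G′)) ≺ K` on def-Y's site carrier (`K ≧ 0`; at the
member `K = B²Cc₁·ℓ(a)⁴·e^{−(1−α′)(1−α_st)δd}` from M5.5's (3.42)₁ and FILE 3a, `s = η⁴`), then `conj b (s•XY i parS G′ U) ≺ (M₂Σ_j‖b_j‖)²·K` on def-Y's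
block carrier — FILE 2's displayed `hL` with `κ = (M₂Σ_j‖b_j‖)²B²Cc₁`, `P(a)⁻¹ = ℓ(a)⁴`, `a_Lδ₀ = (1−α′)(1−α_st)δ`.
[cite: Balaban1985BackgroundPropagators, (3.95) p.411 + (3.21) p.394 + (3.25) p.395; Balaban1984PropagatorsII, (2.83) p.237 + (2.52) p.232] -/
theorem hasMajorant_conj_XY_of_site (hpar : ∀ z w : SiteY i, ‖(parS U z w : 𝔸)‖ ≤ 1 ∧ ‖(((parS U z w)⁻¹ : 𝔸ˣ) : 𝔸)‖ ≤ 1)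
    {M₂ : ℝ} (hM₂ : 0 ≤ M₂) (hrepr : ∀ (v : 𝔸) (j : ι), |b.repr v j| ≤ M₂ * ‖v‖) (s : ℝ)
    {K : (geo9K i).Site → (geo9K i).Site → ℝ} (hK : ∀ a a', 0 ≤ K a a')
    (hGG : HasMajorant (g := toB6 (geo9K i) Rr Hp) (fun p : SiteY i × ι => ιB (blkOf i.D.toDomains p.1))
      (conj b (s • ((Gp U).restrictScalars ℝ * (Gp U).restrictScalars ℝ))) K) :
    HasMajorant (g := toB6 (geo9K i) Rr Hp) (fun q : BlkY i × ι => ιB q.1) (conj b (s • (XY i parS Gp U).restrictScalars ℝ))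
      (fun a a' => (M₂ * ∑ j, ‖b j‖) ^ 2 * K a a') := by
  rw [smul_XY_restrictScalars]
  exact hasMajorant_conj_QpY_sandwich_QpsY i b ιB parS U hpar hM₂ hrepr hK hGG

end Member

end Literature.MathematicalPhysics.QuantumFieldTheory.Balaban1983to89.B9Thm39CinvSandwichQ

end
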